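import Summits.HodgeConjecture.HodgeConjecture.Theorems.F0P3SpectralPacketAnchors   -- ★ (N) FILE 3i p843028: `IsSphericalWith.congr`, `evpAtψ_of_test` (+ ★ `isSphericalWith_comap_eigencharacter`, ★ `isUnitarizable_comap`; ★ 3i′ p845242 is the pointwise-`hunit` re-head)
import HarnessLib

/-!
# (N) FILE 3i″ — THE (P4) «PACKET ANCHORS» WITH THE UNRAMIFIED-MEMBER LAW (ℓ4) READ ONLY OFF `S₀` (F13 «JQ-RAM» WP1 (6): additive `_offS` siblings of ★ 3i `F0P3SpectralPacketAnchors`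
# :85 ∕ :130 ∕ :145 and ★ 3i′ `F0P3SpectralPacketAnchorsPointwise` :55 ∕ :107 ∕ :122) (Rogawski §13.7 pp. 210–212; §12.2 pp. 172–174; §4.5; Cartier §IV.1)

Cell `hodgecm-mathlib` (D-0151), F0∕P3 «U3-mult», crux H413 (`stmt-HodgeConjecture-24833`), route of record `HCCMUnconditional`; programme R90-TF, F13 «JQ-RAM» repair
(director M-159∕M-159b; heir LEAD F0P3a-plan (g22) T21-11 «F13 PLAN OF RECORD» WP1 (6), T21-13 (1) §3′ r2 + (4) «open for the first ✋»; R90-TF LEAD K2E1-plan (g8) LEAD #38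
F13-SCOPE memo 7a2d5558a063a1f1 + LEAD #39 (A) r2; typist-of-record shape = LH7-typ1 (g3) D2′ `Theorems/F0P3SpectralPacketRigidityOffS.lean` 5636ff7b8c5eff12; LH7-typ1 (g3) census
`F13-LEAF-USESITES.v1` 93376ab6fd3c01a7 §2–§3 «Anchors :98 ∕ AnchorsPointwise :76 are `unr`-keyed, but EVERY caller (T-B :284∕:285, UnitarizableByOccurrence) calls at `v ∉ S`, so a
restricted twin is feedable; T-B :187 `hadm4` restrictable»).  Seat: S7 prover R90-C146-p01 (g2) (✋ by file name, LH4 bus 2026-09-04T23:4xZ).  PROOF lane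
(`--kind proof --supports stmt-HodgeConjecture-24833 --as helper`): theorems only; no `def`, no instance, no notation, no named fact, no `sorry`; never imports a `Cruxes/…/Lines` module;
★ 3i ∕ 3i′ UNTOUCHED (rule 69: siblings; their consumers keep them until T-B ED. 6 re-points :284∕:285).

WHY (F13).  Under (R-39)″ the rung-1 letter's unramified-member law becomes (KG1′) `∀ v, Algebra.IsUnramifiedIn (𝓞 L) v.asIdeal → (𝔩 v).UnramLaw`: at a place `v` ramified in
`L∕L⁺` no print-faithful kit has a `K_v`-spherical member in the A-packet of `πⁿ(ξ_v)` (LEAD #36 J-RAM-3), so the kit-wide hypothesis `h4 : ∀ v, (𝔩 v).UnramLaw` of ★ 3i∕3i′ is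
UNINHABITABLE by the kit of record.  The anchors are READ only at `v ∉ S₀` (junction `S₀ := Sψ ∪ S₉ ⊇ Ram(L∕L⁺)`, rung 0's «almost all `v`»), so — §3′ r2, the shape preferred
whenever the ★ head already carries the binder `S₀` and its conclusion is `S₀`-free — the twins take `h4 : ∀ v ∉ S₀, (𝔩 v).UnramLaw` AND the admissibility premise in the same
restricted shape `hadm : ∀ v ∉ S₀, ∀ P h, (sph P h).IsAdmissible` (T-B ED. 6 derives it as `fun v hv P h => hKG3 v P _ (hKG1′ v (hS v hv) P h).1`), both bound right AFTER `hψK`;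
the caller feeds `h4 := fun v hv => hKG1′ v (hS v hv)` (junction binder `hS : ∀ v ∉ S, Algebra.IsUnramifiedIn (𝓞 L) v.asIdeal`, T21-11 §6 (iii)).  `Algebra.IsUnramifiedIn` stays OUT
of this file.  The engine (§1) is POINTWISE at the place in hand (`h4 : (𝔩 v).UnramLaw`, `hadm` at `v`), the most general primitive: the `∉ S₀` heads (§2) and any (KG1′)+`hur`
caller feed it by one application.

THE MATHEMATICS (unchanged from ★ 3i, [Rogawski1990, §13.7 pp. 210–212]).  Off `ram Π`, `Π_v` is unramified with spherical member `π_v⁰ = sph` ((ℓ4) AT `v`); its transport `π_v⁰ ∘ ψ_v`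
is admissible (★ `IsAdmissible.comap`), unitarizable (★ `isUnitarizable_comap`) and — since `ψ_v(K′_v) = K_v` — `K′_v`-spherical WITH eigencharacter the tuple's slot `evpAtψ`
(★ `isSphericalWith_comap_eigencharacter`, ★ `evpAt_of_unr_eq_eigencharacter`, ★ `IsSphericalWith.congr`).  Proofs = ★ 3i′ bodies with the one token change `(h4 v)` ↦ `h4`
(engine) ∕ `(h4 v hv)` (heads), `hadm v` ↦ `hadm` ∕ `hadm v hv`.

CONTENTS.
* §1 `GlobalPacket.exists_anchor_evpAtψ_of_unitarizable_at` — the engine with (ℓ4), admissibility and unitarizability ALL asked at the place `v` and the packet in hand.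
* §2 `SpectralPacketG.anchorsG_of_unitarizable_offS` ∕ `SpectralPacketH.anchorsH_of_unitarizable_offS` — the T-B :284 ∕ :285 consumer twins of ★ 3i′ :107 ∕ :122 (pointwise
  `hunit` = (KU-G)∕(KU-H) rows BY NAME, unchanged), `h4`∕`hadm` off `S₀`; and `SpectralPacketG.anchorsG_offS` ∕ `SpectralPacketH.anchorsH_offS` — the twins of ★ 3i :130 ∕ :145
  (kit-wide `hunit`), same restriction.

HONEST LABEL: count-neutral repair twins; they pay no socket and no citation, and pay nothing on the counted path until the F13 window (T-A ED. 6 + T-B ED. 6 + leaf ED. 7 + AGG) is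
BUILT.  HC_CM is proved only modulo the 7 printed citations (2 remaining named inputs: hLiu418 = stmt-HodgeConjecture-24832, h413 = stmt-HodgeConjecture-24833) until rung 0 closes;
STANDING DEFECT M-159∕M-159b «JQ-RAM» ((KG1) ∧ (KG2) ∧ (KH3′)) until then.

References: [Rogawski1990] §13.7 pp. 210–212, §12.2 pp. 172–174, §13.1 p. 199, §13.3 Thm. 13.3.4 p. 202, §4.5 p. 45, §14.2 p. 232; [CartierCorvallis1979] §IV.1 Cor. 4.1;
[BushnellHenniart2006] §1.1, §11.1.
-/

set_option autoImplicit false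
-- the mandated namespace repeats `HodgeConjecture.HodgeConjecture`, as in every `Theorems/*.lean` of this sub-problem
set_option linter.dupNamespace false

noncomputable section

open NumberField IsDedekindDomain MeasureTheory Filter
open scoped Matrix MatrixGroups

open Literature.NumberTheory Literature.NumberTheory.Automorphic Literature.NumberTheory.Automorphic.UnitaryGroup
open Literature.NumberTheory.Rogawski1990 Literature.NumberTheory.GaloisRepresentations
open Literature.RepresentationTheory.BorelWallach2000 Literature.RepresentationTheory.KonnoKonno2007
open Summit.HodgeConjecture.HodgeConjecture.Cruxes.H413.F0P3InnerFormClassificationV6 (splitForm)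
open Summit.HodgeConjecture.HodgeConjecture.Cruxes.H413.F0P3LocalPacketKit
open Summit.HodgeConjecture.HodgeConjecture.Cruxes.H413.F0P3ArchPacketKit
open Summit.HodgeConjecture.HodgeConjecture.Cruxes.H413.F0P3EigencharacterTransport
open Summit.HodgeConjecture.HodgeConjecture.Cruxes.H413.F0P3ClassTokenChoice (isUnitarizable_comap)

/-! ## §1 The anchor of an unramified place, every kit fact asked AT THAT PLACE only [§13.7 pp. 210–212; §4.5; Cartier §IV.1] -/

namespace Summit.HodgeConjecture.HodgeConjecture.Cruxes.H413.F0P3GlobalPacket.GlobalPacket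

variable {L : Type} [Field L] [NumberField L] [IsCMField L] {H : Matrix (Fin 3) (Fin 3) L}
  {𝔩 : ∀ v : HeightOneSpectrum (𝓞 ↥(maximalRealSubfield L)), LocalPacketKit L (splitForm L 3) v}

/-- **THE (P4) ANCHOR AT THE TUPLE, ALL KIT FACTS ASKED AT THE PLACE IN HAND** (F13 engine): at a place `v ∉ ram Π` where the kit satisfies (ℓ4) `UnramLaw` (`h4`, AT `v`), the
unramified members at `v` are admissible (`hadm`, AT `v`) and the unramified member of THIS packet is unitarizable (`hunit`), with `ψ_v(K′_v) = K_v` and `ν′_v(K′_v) ≠ 0`, the transport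
`π_v⁰ ∘ ψ_v` is an admissible, unitarizable, `K′_v`-spherical class of `G′_v` WITH e.v.p. `Π.evpAtψ ψ (ψ_* ν′) v`.  ★ 3i′ `exists_anchor_evpAtψ_of_unitarizable` line for line with
`(h4 v)` ↦ `h4`, `hadm v` ↦ `hadm`. [cite: Rogawski1990, §13.7 pp. 210–212; §4.5 p. 45; §14.2 p. 232; §12.2 pp. 172–174] [cite: CartierCorvallis1979, §IV.1 Cor. 4.1] -/
theorem exists_anchor_evpAtψ_of_unitarizable_at (Pg : GlobalPacket 𝔩)
    (ψ : ∀ v : HeightOneSpectrum (𝓞 ↥(maximalRealSubfield L)), (cmDatum L 3 H).Local v ≃ₜ* (cmDatum L 3 (splitForm L 3)).Local v)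
    [∀ v : HeightOneSpectrum (𝓞 ↥(maximalRealSubfield L)), MeasurableSpace ((cmDatum L 3 (splitForm L 3)).Local v)]
    [∀ v : HeightOneSpectrum (𝓞 ↥(maximalRealSubfield L)), BorelSpace ((cmDatum L 3 (splitForm L 3)).Local v)]
    [∀ v : HeightOneSpectrum (𝓞 ↥(maximalRealSubfield L)), MeasurableSpace ((cmDatum L 3 H).Local v)]
    [∀ v : HeightOneSpectrum (𝓞 ↥(maximalRealSubfield L)), BorelSpace ((cmDatum L 3 H).Local v)]
    (νG' : ∀ v : HeightOneSpectrum (𝓞 ↥(maximalRealSubfield L)), Measure ((cmDatum L 3 H).Local v))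
    [∀ v, (νG' v).IsMulLeftInvariant] [∀ v, IsFiniteMeasureOnCompacts (νG' v)]
    {v : HeightOneSpectrum (𝓞 ↥(maximalRealSubfield L))}
    (h4 : (𝔩 v).UnramLaw)
    (hadm : ∀ (P : (𝔩 v).Pkt) (h : (𝔩 v).unr P), ((𝔩 v).sph P h).IsAdmissible)
    (hunit : ∀ h : (𝔩 v).unr (Pg.loc v), ((𝔩 v).sph (Pg.loc v) h).IsUnitarizable)
    (hψK : (cmLocalIntegralLevel L 3 H v).map (ψ v : (cmDatum L 3 H).Local v →* (cmDatum L 3 (splitForm L 3)).Local v) =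
      cmLocalIntegralLevel L 3 (splitForm L 3) v)
    (hμK : (νG' v).real (cmLocalIntegralLevel L 3 H v : Set ((cmDatum L 3 H).Local v)) ≠ 0) (hram : v ∉ Pg.ramFinset) :
    ∃ π : IrrClass ((cmDatum L 3 H).Local v), π.IsAdmissible ∧ π.IsUnitarizable ∧
      π.IsSphericalWith (cmLocalIntegralLevel L 3 H v) (νG' v) (Pg.evpAtψ ψ (fun w => (νG' w).map (ψ w)) v) := by
  have hunr : (𝔩 v).unr (Pg.loc v) := Pg.unr_of_not_mem_ramFinset hram
  set c := (𝔩 v).sph (Pg.loc v) hunr with hc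
  have hsph : c.IsSpherical ((cmLocalIntegralLevel L 3 H v).map (ψ v : (cmDatum L 3 H).Local v →* (cmDatum L 3 (splitForm L 3)).Local v)) := by
    rw [hψK]
    exact (h4 (Pg.loc v) hunr).2.1
  refine ⟨IrrClass.comap (ψ v) c, (hadm _ hunr).comap (ψ v), isUnitarizable_comap (ψ v) (hunit hunr), ?_⟩
  have hsw := isSphericalWith_comap_eigencharacter (ψ v) (hadm _ hunr) (isCompact_isOpen_cmLocalIntegralLevel L 3 H v).2
    (isCompact_isOpen_cmLocalIntegralLevel L 3 H v).1 (νG' v) hμK hsph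
  refine hsw.congr fun f hf hK => ?_
  rw [Pg.evpAtψ_of_test ψ _ ⟨hf, hK⟩, Pg.evpAt_of_unr_eq_eigencharacter v _ hunr, hψK]

end Summit.HodgeConjecture.HodgeConjecture.Cruxes.H413.F0P3GlobalPacket.GlobalPacket

/-! ## §2 The (P4) clauses of the letter at the tuple, (ℓ4) and admissibility read only off `S₀` [§13.7 pp. 210–212] -/

namespace Summit.HodgeConjecture.HodgeConjecture.Cruxes.H413.F0P3SpectralPacket

open Summit.HodgeConjecture.HodgeConjecture.Cruxes.H413.F0P3GlobalPacket

variable {L : Type} [Field L] [NumberField L] [IsCMField L] {H : Matrix (Fin 3) (Fin 3) L}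
  {𝔩 : ∀ v : HeightOneSpectrum (𝓞 ↥(maximalRealSubfield L)), LocalPacketKit L (splitForm L 3) v} {𝔞 : ArchPacketKit} {𝔞H : ArchPacketKitH 𝔞}
  {μ : Measure (adelicGroupData (↥(maximalRealSubfield L)) L (IsCMField.complexConj L) 3 (splitForm L 3)).automorphicQuotient}
  [SMulInvariantMeasure (adelicGroupData (↥(maximalRealSubfield L)) L (IsCMField.complexConj L) 3 (splitForm L 3)).Adelic
    (adelicGroupData (↥(maximalRealSubfield L)) L (IsCMField.complexConj L) 3 (splitForm L 3)).automorphicQuotient μ]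
  {DiscH : GlobalPacketH 𝔩 → 𝔞H.PktInfH → Prop}
  [∀ v : HeightOneSpectrum (𝓞 ↥(maximalRealSubfield L)), MeasurableSpace ((cmDatum L 3 (splitForm L 3)).Local v)]
  [∀ v : HeightOneSpectrum (𝓞 ↥(maximalRealSubfield L)), BorelSpace ((cmDatum L 3 (splitForm L 3)).Local v)]
  [∀ v : HeightOneSpectrum (𝓞 ↥(maximalRealSubfield L)), MeasurableSpace ((cmDatum L 3 H).Local v)]
  [∀ v : HeightOneSpectrum (𝓞 ↥(maximalRealSubfield L)), BorelSpace ((cmDatum L 3 H).Local v)]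
  {νG' : ∀ v : HeightOneSpectrum (𝓞 ↥(maximalRealSubfield L)), Measure ((cmDatum L 3 H).Local v)}
  [∀ v, (νG' v).IsMulLeftInvariant] [∀ v, IsFiniteMeasureOnCompacts (νG' v)]

/-- **(P4)-G AT THE TUPLE, (ℓ4) ∕ admissibility OFF `S₀`, unitarizability at the discrete packet** (twin of ★ 3i′ `anchorsG_of_unitarizable`, the T-B :284 head): for a discrete packet
`Q` whose local components' unramified members are unitarizable ((KU-G) BY NAME, `hunit` unchanged), a finite set `S₀` off which `ψ_v(K′_v) = K_v`, the kit satisfies (ℓ4) (`h4 :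
∀ v ∉ S₀, (𝔩 v).UnramLaw`) and unramified members are admissible (`hadm : ∀ v ∉ S₀, …`), and every `v ∉ S₀ ∪ ramG Q`: an admissible unitarizable class of `G′_v`, `K′_v`-spherical WITH
e.v.p. `evpG Q v`.  Binder order: `… hunit S₀ hψK h4 hadm hμK v hv hram` (`h4`, `hadm` right after `hψK`); caller `h4 := fun v hv => hKG1′ v (hS v hv)`.
[cite: Rogawski1990, §13.7 pp. 210–212; §4.5 p. 45; §12.2 pp. 172–174] [cite: CartierCorvallis1979, §IV.1 Cor. 4.1] -/
theorem SpectralPacketG.anchorsG_of_unitarizable_offS (Q : SpectralPacketG 𝔩 𝔞 μ)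
    (ψ : ∀ v : HeightOneSpectrum (𝓞 ↥(maximalRealSubfield L)), (cmDatum L 3 H).Local v ≃ₜ* (cmDatum L 3 (splitForm L 3)).Local v)
    (hunit : ∀ (v : HeightOneSpectrum (𝓞 ↥(maximalRealSubfield L))) (h : (𝔩 v).unr (Q.fin.loc v)), ((𝔩 v).sph (Q.fin.loc v) h).IsUnitarizable)
    (S₀ : Finset (HeightOneSpectrum (𝓞 ↥(maximalRealSubfield L))))
    (hψK : ∀ v ∉ S₀, (cmLocalIntegralLevel L 3 H v).map (ψ v : (cmDatum L 3 H).Local v →* (cmDatum L 3 (splitForm L 3)).Local v) =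
      cmLocalIntegralLevel L 3 (splitForm L 3) v)
    (h4 : ∀ v ∉ S₀, (𝔩 v).UnramLaw)
    (hadm : ∀ v ∉ S₀, ∀ (P : (𝔩 v).Pkt) (h : (𝔩 v).unr P), ((𝔩 v).sph P h).IsAdmissible)
    (hμK : ∀ v : HeightOneSpectrum (𝓞 ↥(maximalRealSubfield L)), (νG' v).real (cmLocalIntegralLevel L 3 H v : Set ((cmDatum L 3 H).Local v)) ≠ 0)
    (v : HeightOneSpectrum (𝓞 ↥(maximalRealSubfield L))) (hv : v ∉ S₀) (hram : v ∉ Q.fin.ramFinset) :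
    ∃ π : IrrClass ((cmDatum L 3 H).Local v), π.IsAdmissible ∧ π.IsUnitarizable ∧
      π.IsSphericalWith (cmLocalIntegralLevel L 3 H v) (νG' v) (Q.evpGψ ψ (fun w => (νG' w).map (ψ w)) v) :=
  Q.fin.exists_anchor_evpAtψ_of_unitarizable_at ψ νG' (h4 v hv) (hadm v hv) (hunit v) (hψK v hv) (hμK v) hram

/-- **(P4)-H AT THE TUPLE, (ℓ4) ∕ admissibility OFF `S₀`, unitarizability at the discrete packet** (twin of ★ 3i′ `anchorsH_of_unitarizable`, the T-B :285 head): the same for a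
discrete `H`-packet `ρ` off `S₀ ∪ ramH ρ`, the anchor being the transported unramified member of `Π(ρ)_v = ξ_H(ρ_v)` (`ρ.imageG`), under (KU-H) «`sph (ξ_H ρ_v)` unitarizable» BY NAME.
Binder order: `… hunit S₀ hψK h4 hadm hμK v hv hram`. [cite: Rogawski1990, §13.7 pp. 210–212; §13.3 Thm. 13.3.4 p. 202; §12.2 pp. 172–174] [cite: CartierCorvallis1979, §IV.1 Cor. 4.1] -/
theorem SpectralPacketH.anchorsH_of_unitarizable_offS (ρ : SpectralPacketH 𝔩 𝔞 𝔞H DiscH)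
    (ψ : ∀ v : HeightOneSpectrum (𝓞 ↥(maximalRealSubfield L)), (cmDatum L 3 H).Local v ≃ₜ* (cmDatum L 3 (splitForm L 3)).Local v)
    (hunit : ∀ (v : HeightOneSpectrum (𝓞 ↥(maximalRealSubfield L))) (h : (𝔩 v).unr (ρ.imageG.loc v)), ((𝔩 v).sph (ρ.imageG.loc v) h).IsUnitarizable)
    (S₀ : Finset (HeightOneSpectrum (𝓞 ↥(maximalRealSubfield L))))
    (hψK : ∀ v ∉ S₀, (cmLocalIntegralLevel L 3 H v).map (ψ v : (cmDatum L 3 H).Local v →* (cmDatum L 3 (splitForm L 3)).Local v) =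
      cmLocalIntegralLevel L 3 (splitForm L 3) v)
    (h4 : ∀ v ∉ S₀, (𝔩 v).UnramLaw)
    (hadm : ∀ v ∉ S₀, ∀ (P : (𝔩 v).Pkt) (h : (𝔩 v).unr P), ((𝔩 v).sph P h).IsAdmissible)
    (hμK : ∀ v : HeightOneSpectrum (𝓞 ↥(maximalRealSubfield L)), (νG' v).real (cmLocalIntegralLevel L 3 H v : Set ((cmDatum L 3 H).Local v)) ≠ 0)
    (v : HeightOneSpectrum (𝓞 ↥(maximalRealSubfield L))) (hv : v ∉ S₀) (hram : v ∉ ρ.ramFinsetH) :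
    ∃ π : IrrClass ((cmDatum L 3 H).Local v), π.IsAdmissible ∧ π.IsUnitarizable ∧
      π.IsSphericalWith (cmLocalIntegralLevel L 3 H v) (νG' v) (ρ.evpHψ ψ (fun w => (νG' w).map (ψ w)) v) :=
  ρ.imageG.exists_anchor_evpAtψ_of_unitarizable_at ψ νG' (h4 v hv) (hadm v hv) (hunit v) (hψK v hv) (hμK v) hram

/-- **(P4)-G AT THE TUPLE, (ℓ4) ∕ admissibility OFF `S₀`, kit-wide unitarizability** (twin of ★ 3i `anchorsG` :130; `hunit : ∀ v P h` as there).  Binder order: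
`… hunit S₀ hψK h4 hadm hμK v hv hram`. [cite: Rogawski1990, §13.7 pp. 210–212; §4.5 p. 45] [cite: CartierCorvallis1979, §IV.1 Cor. 4.1] -/
theorem SpectralPacketG.anchorsG_offS (Q : SpectralPacketG 𝔩 𝔞 μ)
    (ψ : ∀ v : HeightOneSpectrum (𝓞 ↥(maximalRealSubfield L)), (cmDatum L 3 H).Local v ≃ₜ* (cmDatum L 3 (splitForm L 3)).Local v)
    (hunit : ∀ (v : HeightOneSpectrum (𝓞 ↥(maximalRealSubfield L))) (P : (𝔩 v).Pkt) (h : (𝔩 v).unr P), ((𝔩 v).sph P h).IsUnitarizable)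
    (S₀ : Finset (HeightOneSpectrum (𝓞 ↥(maximalRealSubfield L))))
    (hψK : ∀ v ∉ S₀, (cmLocalIntegralLevel L 3 H v).map (ψ v : (cmDatum L 3 H).Local v →* (cmDatum L 3 (splitForm L 3)).Local v) =
      cmLocalIntegralLevel L 3 (splitForm L 3) v)
    (h4 : ∀ v ∉ S₀, (𝔩 v).UnramLaw)
    (hadm : ∀ v ∉ S₀, ∀ (P : (𝔩 v).Pkt) (h : (𝔩 v).unr P), ((𝔩 v).sph P h).IsAdmissible)
    (hμK : ∀ v : HeightOneSpectrum (𝓞 ↥(maximalRealSubfield L)), (νG' v).real (cmLocalIntegralLevel L 3 H v : Set ((cmDatum L 3 H).Local v)) ≠ 0)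
    (v : HeightOneSpectrum (𝓞 ↥(maximalRealSubfield L))) (hv : v ∉ S₀) (hram : v ∉ Q.fin.ramFinset) :
    ∃ π : IrrClass ((cmDatum L 3 H).Local v), π.IsAdmissible ∧ π.IsUnitarizable ∧
      π.IsSphericalWith (cmLocalIntegralLevel L 3 H v) (νG' v) (Q.evpGψ ψ (fun w => (νG' w).map (ψ w)) v) :=
  Q.fin.exists_anchor_evpAtψ_of_unitarizable_at ψ νG' (h4 v hv) (hadm v hv) (hunit v _) (hψK v hv) (hμK v) hram

/-- **(P4)-H AT THE TUPLE, (ℓ4) ∕ admissibility OFF `S₀`, kit-wide unitarizability** (twin of ★ 3i `anchorsH` :145; `hunit : ∀ v P h` as there).  Binder order: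
`… hunit S₀ hψK h4 hadm hμK v hv hram`. [cite: Rogawski1990, §13.7 pp. 210–212; §13.3 Thm. 13.3.4 p. 202] [cite: CartierCorvallis1979, §IV.1 Cor. 4.1] -/
theorem SpectralPacketH.anchorsH_offS (ρ : SpectralPacketH 𝔩 𝔞 𝔞H DiscH)
    (ψ : ∀ v : HeightOneSpectrum (𝓞 ↥(maximalRealSubfield L)), (cmDatum L 3 H).Local v ≃ₜ* (cmDatum L 3 (splitForm L 3)).Local v)
    (hunit : ∀ (v : HeightOneSpectrum (𝓞 ↥(maximalRealSubfield L))) (P : (𝔩 v).Pkt) (h : (𝔩 v).unr P), ((𝔩 v).sph P h).IsUnitarizable)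
    (S₀ : Finset (HeightOneSpectrum (𝓞 ↥(maximalRealSubfield L))))
    (hψK : ∀ v ∉ S₀, (cmLocalIntegralLevel L 3 H v).map (ψ v : (cmDatum L 3 H).Local v →* (cmDatum L 3 (splitForm L 3)).Local v) =
      cmLocalIntegralLevel L 3 (splitForm L 3) v)
    (h4 : ∀ v ∉ S₀, (𝔩 v).UnramLaw)
    (hadm : ∀ v ∉ S₀, ∀ (P : (𝔩 v).Pkt) (h : (𝔩 v).unr P), ((𝔩 v).sph P h).IsAdmissible)
    (hμK : ∀ v : HeightOneSpectrum (𝓞 ↥(maximalRealSubfield L)), (νG' v).real (cmLocalIntegralLevel L 3 H v : Set ((cmDatum L 3 H).Local v)) ≠ 0)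
    (v : HeightOneSpectrum (𝓞 ↥(maximalRealSubfield L))) (hv : v ∉ S₀) (hram : v ∉ ρ.ramFinsetH) :
    ∃ π : IrrClass ((cmDatum L 3 H).Local v), π.IsAdmissible ∧ π.IsUnitarizable ∧
      π.IsSphericalWith (cmLocalIntegralLevel L 3 H v) (νG' v) (ρ.evpHψ ψ (fun w => (νG' w).map (ψ w)) v) :=
  ρ.imageG.exists_anchor_evpAtψ_of_unitarizable_at ψ νG' (h4 v hv) (hadm v hv) (hunit v _) (hψK v hv) (hμK v) hram

end Summit.HodgeConjecture.HodgeConjecture.Cruxes.H413.F0P3SpectralPacket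

end
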